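import Literature.Geometry.Kaehler.ComplexTorusCyclotomicAutomorphismEndomorphismAlgebra
import Literature.Geometry.Kaehler.ComplexTorusHodgeGroupTorusIffCM
import HarnessLib

/-!
# The Mumford–Tate group of a complex torus with an automorphism of characteristic polynomial `Φ_d` and primitive
# type is an algebraic torus; the `ζ_5`-surface and the `ζ_3`-curve have commutative Hodge groups

Layer `Literature/Geometry/Kaehler`, namespace `Literature.Geometry.Kaehler.ComplexTorus`; lane `lit-hodgefound`
(Track 2 foundations library), Layer A2/A3 junction, row «A2-26(ge)» (self-proposed 2026-08-28, prover seat
`lit-hodgefound-p10`, generation 31, FILE 13).  FILE 12: `(X, u) ≅ (ℂ^Φ/Φ(𝔞), ζ_d)` with `Φ` primitive has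
`End_ℚ(X) ≅ K = ℚ(ζ_d)`, a (commutative, reduced) field of degree `[K : ℚ] = rk H_1(X, ℤ)`.  That is exactly the
input of Mumford's criterion as the tree has it (`isTorusSubgroup_mumfordTateGroupC_of_le_endAlgRat`: a commutative
reduced subalgebra `T ≤ End_ℚ(X)` with `dim_ℚ T = rk`, Gordon Prop. 2.12 ⟹ / Milne ISV Prop. 14.10 (a) ⟹ (c)), with
`T = End_ℚ(X)` itself.  Hence: **`MT(X)(ℂ)` is an algebraic torus, `Hg(X)(ℂ)` (in `GL`) is an algebraic torus, and
`Hg(X)(ℂ)` is commutative** — for every such `(X, u)`, in particular for every `2`-dimensional complex torus with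
an endomorphism of order `5` and every one-dimensional complex torus with an endomorphism of order `3`.

WHAT IS PROVED (theorems only; no `def`, no instance, no named fact; net debt 0).
* §1 `isReduced_endAlgRat_of_iso`, `finrank_endAlgRat_eq_card_of_iso`, **`isTorusSubgroup_mumfordTateGroupC_of_iso`**,
  **`isTorusSubgroup_map_toGL_hodgeGroupC_of_iso`**, **`hodgeGroupC_comm_of_iso`**.
* §2 **`isTorusSubgroup_mumfordTateGroupC_of_orderOf_eq_five`**, `isTorusSubgroup_map_toGL_hodgeGroupC_of_orderOf_eq_five`,
  **`hodgeGroupC_comm_of_orderOf_eq_five`**.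
* §3 `isTorusSubgroup_mumfordTateGroupC_of_orderOf_eq_three`, `hodgeGroupC_comm_of_orderOf_eq_three`.

Sources.  B. B. Gordon, *A survey of the Hodge conjecture for abelian varieties* (1999), §2 Prop. 2.12 (Mumford:
`A` of CM type ⟺ `Hg(A)` is a torus), as vendored by the tree; J. S. Milne, *Introduction to Shimura varieties*
(2005), §14 Prop. 14.10; G. Shimura, *Abelian Varieties with Complex Multiplication and Modular Functions* (1998),
§5.1 Prop. 6, p. 37; Ch. Birkenhake, H. Lange, *Complex Abelian Varieties*, 2nd ed. (2004), §13.3, §17.3 (Hodge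
group of an abelian variety of CM type) — not held (acq-10211), locator as cited by this lane's earlier rows.

## References

* [Gordon1997] B. B. Gordon, *A survey of the Hodge conjecture for abelian varieties*, Appendix B in J. D. Lewis,
  *A Survey of the Hodge Conjecture*, CRM Monograph Series 10, AMS (1999), §2 Prop. 2.12.
* [Milne2005ShimuraVarieties] J. S. Milne, *Introduction to Shimura varieties*, Clay Math. Proc. 4 (2005), §14
  Prop. 14.10.
* [Shimura1998] G. Shimura, *Abelian Varieties with Complex Multiplication and Modular Functions*, Princeton
  Univ. Press (1998), §5.1 Prop. 6 p. 37.
* [BirkenhakeLange2004] Ch. Birkenhake, H. Lange, *Complex Abelian Varieties*, 2nd ed., Grundlehren 302 (2004),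
  §13.3, §17.3.
-/

noncomputable section

open scoped Classical nonZeroDivisors NumberField Manifold ContDiff MatrixGroups
open NumberField Module Polynomial

namespace Literature.Geometry.Kaehler

namespace ComplexTorus

open Literature.NumberTheory.Automorphic (IsTorusSubgroup)
open Literature.AlgebraicGeometry.Motives (CMType)
open Literature.NumberTheory.ComplexMultiplication.CMTypeLattice (periodIso basisIndex card_basisIndex_eq_finrank)

/-! ### §1 Primitive type: `MT(X)(ℂ)` and `Hg(X)(ℂ)` are algebraic tori, `Hg(X)(ℂ)` is commutative -/

section General

variable {ι : Type} [Fintype ι] [DecidableEq ι] {E : Type} [NormedAddCommGroup E] [NormedSpace ℂ E]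
  {P : (ι → ℝ) ≃L[ℝ] E} {K : Type} [Field K] [NumberField K]

/-- **`End_ℚ(X)` is reduced** for `X ≅ ℂ^Φ/Φ(𝔞)` with the model simple (it is a field `≅ K`).
[cite: Shimura1998, §5.1 Prop. 6, p. 37] -/
theorem isReduced_endAlgRat_of_iso {Φ : CMType K} {I : (FractionalIdeal (𝓞 K)⁰ K)ˣ}
    (hS : ComplexTorus.IsSimple (periodIso Φ I)) (e : ComplexTorus P ≃+ ComplexTorus (periodIso Φ I))
    (he : ContMDiff 𝓘(ℂ, E) 𝓘(ℂ, Φ.1 → ℂ) ω e) (he₂ : ContMDiff 𝓘(ℂ, Φ.1 → ℂ) 𝓘(ℂ, E) ω e.symm) :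
    IsReduced (endAlgRat P) := by
  obtain ⟨f⟩ := nonempty_algEquiv_endAlgRat_of_iso (P := P) hS e he he₂
  exact isReduced_of_injective f.symm f.symm.injective

/-- **`dim_ℚ End_ℚ(X) = rk H_1(X, ℤ)`** (`= [K : ℚ]`) for `X ≅ ℂ^Φ/Φ(𝔞)` with the model simple: the CM algebra has
full degree. [cite: Shimura1998, §5.1 Prop. 6, p. 37] [cite: Milne2005ShimuraVarieties, §14 Def. 14.9] -/
theorem finrank_endAlgRat_eq_card_of_iso {Φ : CMType K} {I : (FractionalIdeal (𝓞 K)⁰ K)ˣ}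
    (hS : ComplexTorus.IsSimple (periodIso Φ I)) (e : ComplexTorus P ≃+ ComplexTorus (periodIso Φ I))
    (he : ContMDiff 𝓘(ℂ, E) 𝓘(ℂ, Φ.1 → ℂ) ω e) (he₂ : ContMDiff 𝓘(ℂ, Φ.1 → ℂ) 𝓘(ℂ, E) ω e.symm) :
    finrank ℚ (endAlgRat P) = Fintype.card ι := by
  rw [finrank_endAlgRat_of_iso hS e he he₂, IsIsomorphic.card_eq ⟨e, he, he₂⟩, card_basisIndex_eq_finrank]

/-- **THE MUMFORD–TATE GROUP `MT(X)(ℂ)` IS AN ALGEBRAIC TORUS** for `X ≅ ℂ^Φ/Φ(𝔞)` with the model simple (`Φ`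
primitive): `End_ℚ(X) ≅ ℚ(ζ_d)` is a commutative field of full degree inside `End_ℚ(X)` — Mumford's criterion
(«if `A` has CM then `Hg(A)` is a torus»). [cite: Gordon1997, §2 Prop. 2.12 (⟹)] [cite: Milne2005ShimuraVarieties, §14 Prop. 14.10 ((a) ⟹ (c))]
[cite: BirkenhakeLange2004, §17.3] -/
theorem isTorusSubgroup_mumfordTateGroupC_of_iso {Φ : CMType K} {I : (FractionalIdeal (𝓞 K)⁰ K)ˣ}
    (hS : ComplexTorus.IsSimple (periodIso Φ I)) (e : ComplexTorus P ≃+ ComplexTorus (periodIso Φ I))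
    (he : ContMDiff 𝓘(ℂ, E) 𝓘(ℂ, Φ.1 → ℂ) ω e) (he₂ : ContMDiff 𝓘(ℂ, Φ.1 → ℂ) 𝓘(ℂ, E) ω e.symm) :
    IsTorusSubgroup (mumfordTateGroupC P) := by
  haveI := isReduced_endAlgRat_of_iso hS e he he₂
  exact isTorusSubgroup_mumfordTateGroupC_of_le_endAlgRat P (endAlgRat P) le_rfl
    (fun a ha b hb ↦ congrArg Subtype.val (endAlgRat_comm_of_iso hS e he he₂ ⟨a, ha⟩ ⟨b, hb⟩))
    (finrank_endAlgRat_eq_card_of_iso hS e he he₂)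

/-- **THE HODGE GROUP `Hg(X)(ℂ)` (read in `GL`) IS AN ALGEBRAIC TORUS** for `X ≅ ℂ^Φ/Φ(𝔞)` with the model simple.
[cite: Gordon1997, §2 Prop. 2.12 (⟹)] [cite: Milne2005ShimuraVarieties, §14 Prop. 14.10] -/
theorem isTorusSubgroup_map_toGL_hodgeGroupC_of_iso {Φ : CMType K} {I : (FractionalIdeal (𝓞 K)⁰ K)ˣ}
    (hS : ComplexTorus.IsSimple (periodIso Φ I)) (e : ComplexTorus P ≃+ ComplexTorus (periodIso Φ I))
    (he : ContMDiff 𝓘(ℂ, E) 𝓘(ℂ, Φ.1 → ℂ) ω e) (he₂ : ContMDiff 𝓘(ℂ, Φ.1 → ℂ) 𝓘(ℂ, E) ω e.symm) :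
    IsTorusSubgroup ((hodgeGroupC P).map Matrix.SpecialLinearGroup.toGL) := by
  haveI := isReduced_endAlgRat_of_iso hS e he he₂
  exact isTorusSubgroup_map_toGL_hodgeGroupC_of_le_endAlgRat P (endAlgRat P) le_rfl
    (fun a ha b hb ↦ congrArg Subtype.val (endAlgRat_comm_of_iso hS e he he₂ ⟨a, ha⟩ ⟨b, hb⟩))
    (finrank_endAlgRat_eq_card_of_iso hS e he he₂)

/-- **THE HODGE GROUP `Hg(X)(ℂ)` IS COMMUTATIVE** for `X ≅ ℂ^Φ/Φ(𝔞)` with the model simple.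
[cite: Gordon1997, §2 Prop. 2.12] [cite: BirkenhakeLange2004, §17.3] -/
theorem hodgeGroupC_comm_of_iso {Φ : CMType K} {I : (FractionalIdeal (𝓞 K)⁰ K)ˣ}
    (hS : ComplexTorus.IsSimple (periodIso Φ I)) (e : ComplexTorus P ≃+ ComplexTorus (periodIso Φ I))
    (he : ContMDiff 𝓘(ℂ, E) 𝓘(ℂ, Φ.1 → ℂ) ω e) (he₂ : ContMDiff 𝓘(ℂ, Φ.1 → ℂ) 𝓘(ℂ, E) ω e.symm)
    {M N : Matrix.SpecialLinearGroup ι ℂ} (hM : M ∈ hodgeGroupC P) (hN : N ∈ hodgeGroupC P) : M * N = N * M := by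
  haveI := isReduced_endAlgRat_of_iso hS e he he₂
  exact hodgeGroupC_comm_of_comm_isReduced_le_endAlgRat P (endAlgRat P) le_rfl
    (fun a ha b hb ↦ congrArg Subtype.val (endAlgRat_comm_of_iso hS e he he₂ ⟨a, ha⟩ ⟨b, hb⟩))
    (finrank_endAlgRat_eq_card_of_iso hS e he he₂) hM hN

end General

/-! ### §2 The `ζ_5`-surface: `MT` and `Hg` are tori, `Hg` is commutative -/

section Five

variable {ι : Type} [Fintype ι] [DecidableEq ι] {E : Type} [NormedAddCommGroup E] [NormedSpace ℂ E]
  {P : (ι → ℝ) ≃L[ℝ] E}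

set_option backward.isDefEq.respectTransparency false in -- Mathlib's instance
-- `IsCyclotomicExtension {5} ℚ (CyclotomicField 5 ℚ)` is keyed on `CyclotomicField.algebra`, the goal on
-- `DivisionRing.toRatAlgebra` (same workaround as FILE 1 `isAbelianVariety_of_charpoly_eq_cyclotomic`)
/-- **The Mumford–Tate group of a `2`-dimensional complex torus with an endomorphism of order `5` is an algebraic
torus** (`X ≅ ℂ²/Φ(𝓞_{ℚ(ζ_5)})` with `Φ` primitive: a simple CM abelian surface).
[cite: Gordon1997, §2 Prop. 2.12 (⟹)] [cite: Milne2005ShimuraVarieties, §14 Prop. 14.10] [cite: BirkenhakeLange2004, §13.3, §17.3] -/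
theorem isTorusSubgroup_mumfordTateGroupC_of_orderOf_eq_five {A : Matrix ι ι ℤ} (hA : A ∈ endRingInt P)
    (hord : orderOf A = 5) (hdim : finrank ℂ E = 2) : IsTorusSubgroup (mumfordTateGroupC P) := by
  have hζ := IsCyclotomicExtension.zeta_spec 5 ℚ (CyclotomicField 5 ℚ)
  obtain ⟨Φ, e, he, he', -⟩ := exists_iso_periodIso_one_of_orderOf_eq_five hζ hA hord hdim
  exact isTorusSubgroup_mumfordTateGroupC_of_iso (isSimple_periodIso_five Φ 1) e he he'

set_option backward.isDefEq.respectTransparency false in -- see above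
/-- **The Hodge group (in `GL`) of a `2`-dimensional complex torus with an endomorphism of order `5` is an algebraic
torus.** [cite: Gordon1997, §2 Prop. 2.12 (⟹)] [cite: Milne2005ShimuraVarieties, §14 Prop. 14.10] -/
theorem isTorusSubgroup_map_toGL_hodgeGroupC_of_orderOf_eq_five {A : Matrix ι ι ℤ} (hA : A ∈ endRingInt P)
    (hord : orderOf A = 5) (hdim : finrank ℂ E = 2) :
    IsTorusSubgroup ((hodgeGroupC P).map Matrix.SpecialLinearGroup.toGL) := by
  have hζ := IsCyclotomicExtension.zeta_spec 5 ℚ (CyclotomicField 5 ℚ)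
  obtain ⟨Φ, e, he, he', -⟩ := exists_iso_periodIso_one_of_orderOf_eq_five hζ hA hord hdim
  exact isTorusSubgroup_map_toGL_hodgeGroupC_of_iso (isSimple_periodIso_five Φ 1) e he he'

set_option backward.isDefEq.respectTransparency false in -- see above
/-- **The Hodge group of a `2`-dimensional complex torus with an endomorphism of order `5` is commutative.**
[cite: Gordon1997, §2 Prop. 2.12] [cite: BirkenhakeLange2004, §17.3] -/
theorem hodgeGroupC_comm_of_orderOf_eq_five {A : Matrix ι ι ℤ} (hA : A ∈ endRingInt P) (hord : orderOf A = 5)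
    (hdim : finrank ℂ E = 2) {M N : Matrix.SpecialLinearGroup ι ℂ} (hM : M ∈ hodgeGroupC P)
    (hN : N ∈ hodgeGroupC P) : M * N = N * M := by
  have hζ := IsCyclotomicExtension.zeta_spec 5 ℚ (CyclotomicField 5 ℚ)
  obtain ⟨Φ, e, he, he', -⟩ := exists_iso_periodIso_one_of_orderOf_eq_five hζ hA hord hdim
  exact hodgeGroupC_comm_of_iso (isSimple_periodIso_five Φ 1) e he he' hM hN

end Five

/-! ### §3 The `ζ_3`-curve: `MT` is a torus, `Hg` is commutative -/

section Three

variable {ι : Type} [Fintype ι] [DecidableEq ι] {E : Type} [NormedAddCommGroup E] [NormedSpace ℂ E]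
  {P : (ι → ℝ) ≃L[ℝ] E}

set_option backward.isDefEq.respectTransparency false in -- see §2
/-- **The Mumford–Tate group of a one-dimensional complex torus with an endomorphism of order `3` is an algebraic
torus** (a CM elliptic curve, `End_ℚ ≅ ℚ(ζ_3)`). [cite: Gordon1997, §2 Prop. 2.12 (⟹)] [cite: Milne2005ShimuraVarieties, §14 Prop. 14.10] -/
theorem isTorusSubgroup_mumfordTateGroupC_of_orderOf_eq_three {A : Matrix ι ι ℤ} (hA : A ∈ endRingInt P)
    (hord : orderOf A = 3) (hdim : finrank ℂ E = 1) : IsTorusSubgroup (mumfordTateGroupC P) := by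
  have hζ := IsCyclotomicExtension.zeta_spec 3 ℚ (CyclotomicField 3 ℚ)
  have h2 : finrank ℚ (CyclotomicField 3 ℚ) = 2 := by
    rw [IsCyclotomicExtension.finrank (n := 3) (CyclotomicField 3 ℚ) (cyclotomic.irreducible_rat (by norm_num)),
      Nat.totient_prime Nat.prime_three]
  obtain ⟨Φ, e, he, he', -⟩ := exists_iso_periodIso_one_of_orderOf_eq_three hζ hA hord hdim
  exact isTorusSubgroup_mumfordTateGroupC_of_iso (isSimple_periodIso_of_finrank_eq_two h2 Φ 1) e he he'

set_option backward.isDefEq.respectTransparency false in -- see §2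
/-- **The Hodge group of a one-dimensional complex torus with an endomorphism of order `3` is commutative.**
[cite: Gordon1997, §2 Prop. 2.12] -/
theorem hodgeGroupC_comm_of_orderOf_eq_three {A : Matrix ι ι ℤ} (hA : A ∈ endRingInt P) (hord : orderOf A = 3)
    (hdim : finrank ℂ E = 1) {M N : Matrix.SpecialLinearGroup ι ℂ} (hM : M ∈ hodgeGroupC P)
    (hN : N ∈ hodgeGroupC P) : M * N = N * M := by
  have hζ := IsCyclotomicExtension.zeta_spec 3 ℚ (CyclotomicField 3 ℚ)
  have h2 : finrank ℚ (CyclotomicField 3 ℚ) = 2 := by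
    rw [IsCyclotomicExtension.finrank (n := 3) (CyclotomicField 3 ℚ) (cyclotomic.irreducible_rat (by norm_num)),
      Nat.totient_prime Nat.prime_three]
  obtain ⟨Φ, e, he, he', -⟩ := exists_iso_periodIso_one_of_orderOf_eq_three hζ hA hord hdim
  exact hodgeGroupC_comm_of_iso (isSimple_periodIso_of_finrank_eq_two h2 Φ 1) e he he' hM hN

end Three

end ComplexTorus

end Literature.Geometry.Kaehler
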